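import Literature.AlgebraicGeometry.Motives.LinearSubspaceSectionsRatEquiv
import Literature.AlgebraicGeometry.Motives.LinesInProjectiveSpace
import Literature.AlgebraicGeometry.Motives.LinearSubspacesChowNonTorsion
import Literature.AlgebraicGeometry.Motives.VarietiesGeometricallyIntegralProofs
import Literature.RingTheory.MvPolynomial.CubicFormPlaneChains
import HarnessLib

/-!
# Any two planes of a cubic hypersurface of dimension `≥ 15` are rationally equivalent (elementary)

Input (b) of the reduction `Mboro2018_chowTwo_cubic_of_inputs`
(`Motives/LinearSubspacesChowNonTorsion`) of Mboro's Cor. 2.9 (`Motives/LinearSubspacesGenerateChow`)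
asks that any two planes `Π, Π' ⊆ X` of a smooth cubic hypersurface `X ⊆ ℙⁿ⁺¹`, `n ≥ 9`, have
rationally equivalent prime cycles. In print (arXiv:1701.04488, Cor. 2.9 (ii), p. 12) this is
`CH₀(F₂(X)) ≅ ℤ` (Debarre–Manivel; the variety of planes `F₂(X)` is Fano exactly for `n ≥ 9`),
i.e. the rational connectedness of a Fano variety, which the tree does not have. This file proves
the statement in the ELEMENTARY range `n ≥ 15`, for ANY hypersurface `X = V₊(F)` of a prime form
`F` of degree `≥ 2` containing the planes in question (no smoothness), by chains of planes of `X`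
in which two consecutive planes span a `3`-plane of `X` — hence have the same class, both being
hyperplane sections of that `3`-plane (`Hypersurface.ofPoint_eq_ofPoint_of_isLinearSubspacePoint`,
`Motives/LinearSubspaceSectionsRatEquiv`; Fulton, Example 2.5.1 with Cor. 2.4.2). The chains come
from the linear algebra of `Literature/RingTheory/MvPolynomial/CubicFormPlaneChains.lean`
(isotropic subspaces `W ⊆ kⁿ⁺²` of the cubic form): two planes through a common line lie in two
`3`-planes of `X` through a common plane when `14 + 2 < n + 2` (`2`-chains of `3`-planes exist by
dimension count exactly in this range); two planes through a common point
are reduced to that case inside the cone of lines through the point (`9 + 3 < n + 2`); two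
arbitrary planes are joined through a third vertex (`5 + 2 < n + 2`) and planes through the
joining lines (`6 + 2 < n + 2`).

* the dictionary between `r`-plane points `z` of `X` and isotropic `(r+1)`-subspaces `W`
  (`𝔭(i z) = {G | G|_W = 0}`): `exists_isLinearSubspacePoint_of_frame` (frame ↦ point),
  `exists_submodule_of_isLinearSubspacePoint` (point ↦ subspace), `specializes_of_submodule_le`
  (`W ≤ M ⇒ μ ⤳ z`), `eq_of_submodule_eq`;
* `ofPoint_eq_ofPoint_of_le_isotropic` — two `s`-planes of `X` in a common isotropic
  `(s+2)`-subspace have the same class in `CH_s(X)`;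
* `ofPoint_eq_of_two_le_finrank_inf`, `…_of_one_le_finrank_inf`, `ofPoint_eq_of_cubic` — the chain
  argument by the dimension of `W ∩ W'`;
* `isRationallyEquivalent_of_isLinearSubspacePoint_two` — **input (b) for `n ≥ 15`** in the binder
  shape of `Mboro2018_chowTwo_cubic_of_inputs` (smooth cubic `n`-fold: `IsSmoothProjective`,
  `F.IsHomogeneous 3`, `Irreducible F`, closed immersion onto `V₊(F)`);
* `nonempty_addEquiv_int_of_chowGeneratedByPlanes` — consequently, for `n ≥ 15`, clause (ii) of
  Cor. 2.9 (`CH₂(X) ≃ ℤ`) follows from clause (i) (generation by planes) alone.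

Everything is proved; no definitions, no named facts. This is NOT the printed proof of Cor. 2.9 (ii)
(whose range `n ≥ 9` is the Fano threshold of `F₂(X)`); it is the part of input (b) reachable by
linear algebra, recorded for the reduction `Mboro2018_chowTwo_cubic_of_inputs`.

## References

* R. Mboro, *Remarks on the CH₂ of cubic hypersurfaces*, arXiv:1701.04488, Cor. 2.9 (p. 12). [Mboro2018]
* W. Fulton, *Intersection Theory*, 2nd ed. (1998), Example 2.5.1, Cor. 2.4.2. [Fulton1998]
* O. Debarre, L. Manivel, Sur la variété des espaces linéaires contenus dans une intersection
  complète, Math. Ann. 312 (1998), Thm. 2.1 (sharp ranges for linear subspaces). [DebarreManivel1998]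
-/

noncomputable section

universe u

open CategoryTheory AlgebraicGeometry Order Topology
open Literature.AlgebraicGeometry.Motives.Segre
open Literature.RingTheory.MvPolynomial

attribute [local instance] MvPolynomial.gradedAlgebra

namespace Literature.AlgebraicGeometry.Motives

namespace Hypersurface

variable {K : Type u} [Field K] {d : ℕ} {X : SchemeOver K}
  (i : X ⟶ projectiveSpace (d + 1) K) [IsClosedImmersion i.left]
  {F : MvPolynomial (Fin (d + 1 + 1)) K}

open ProjSpace

/-! ### Plane points of `X` and isotropic subspaces of `kᴺ⁺¹` -/

section Dictionary

variable (hrange : Set.range i.left.base = ProjectiveSpectrum.zeroLocus (MvPolynomial.homogeneousSubmodule (Fin (d + 1 + 1)) K) {F})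

/-- Membership in the ideal of linear forms vanishing on `span(w)` forces vanishing on `span(w)`.
[folklore] -/
theorem forall_eval_eq_zero_of_mem_span {t u : ℕ} {L : Fin t → MvPolynomial (Fin (d + 1 + 1)) K}
    {w : Fin u → Fin (d + 1 + 1) → K}
    (hvan : ∀ j, ∀ v ∈ Submodule.span K (Set.range w), MvPolynomial.eval v (L j) = 0)
    {G : MvPolynomial (Fin (d + 1 + 1)) K} (hG : G ∈ Ideal.span (Set.range L)) :
    ∀ v ∈ Submodule.span K (Set.range w), MvPolynomial.eval v G = 0 := by
  intro v hv
  have hle : Ideal.span (Set.range L) ≤ RingHom.ker (MvPolynomial.eval v) := by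
    rw [Ideal.span_le]
    rintro _ ⟨j, rfl⟩
    exact (RingHom.mem_ker).2 (hvan j v hv)
  exact (RingHom.mem_ker).1 (hle hG)

include hrange in
/-- **From an isotropic frame to a linear-subspace point of `X`.** For `r + 1` linearly independent
vectors `w_j ∈ K^{d+2}` on whose span `F` vanishes (`K` infinite, `i : X ↪ ℙ^{d+1}` a closed
immersion onto `V₊(F)`), there is an `r`-plane point `μ` of `X` — over the generic point of
`ℙ(span w)` — whose homogeneous prime consists exactly of the polynomials vanishing on `span(w)`.
[cite: Hartshorne1977, I Ex. 2.11] -/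
theorem exists_isLinearSubspacePoint_of_frame [Infinite K] {r m : ℕ} (hm : m = r + 1)
    (hr : r ≤ d + 1) {w : Fin m → Fin (d + 1 + 1) → K} (hw : LinearIndependent K w)
    (hiso : ∀ v ∈ Submodule.span K (Set.range w), MvPolynomial.eval v F = 0) :
    ∃ μ : ↥X.left, IsLinearSubspacePoint r (d + 1) i μ ∧
      ∀ G : MvPolynomial (Fin (d + 1 + 1)) K,
        G ∈ (ProjectiveSpectrum.asHomogeneousIdeal (𝒜 := (MvPolynomial.homogeneousSubmodule (Fin (d + 1 + 1)) K)) (i.left.base μ)).toIdeal ↔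
          ∀ v ∈ Submodule.span K (Set.range w), MvPolynomial.eval v G = 0 := by
  subst hm
  obtain ⟨t, L, ht, hL, hhom, hvan, hall⟩ := exists_linearForms_forall_mem_ideal_span_vanishing hw
  obtain rfl : t = d + 1 - r := by omega
  have htle : d + 1 - r ≤ d + 1 := Nat.sub_le _ _
  have hℓI : (ProjectiveSpectrum.asHomogeneousIdeal (𝒜 := (MvPolynomial.homogeneousSubmodule (Fin (d + 1 + 1)) K))
      (linearSubspacePoint L hL hhom htle)).toIdeal = Ideal.span (Set.range L) :=
    toIdeal_linearSubspacePoint L hL hhom htle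
  have hset : ((ProjectiveSpectrum.asHomogeneousIdeal (𝒜 := (MvPolynomial.homogeneousSubmodule (Fin (d + 1 + 1)) K))
      (linearSubspacePoint L hL hhom htle) : HomogeneousIdeal (MvPolynomial.homogeneousSubmodule (Fin (d + 1 + 1)) K)) :
        Set (MvPolynomial (Fin (d + 1 + 1)) K)) =
      (Ideal.span (Set.range L) : Set (MvPolynomial (Fin (d + 1 + 1)) K)) := by
    rw [← hℓI]
    rfl
  -- the generic point of `ℙ(span w)` lies on `V₊(F) = i(X)`
  have hℓX : linearSubspacePoint L hL hhom htle ∈ Set.range i.left.base := by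
    set P : ProjectiveSpectrum (MvPolynomial.homogeneousSubmodule (Fin (d + 1 + 1)) K) :=
      linearSubspacePoint L hL hhom htle with hP
    have key : P ∈ ProjectiveSpectrum.zeroLocus
        (MvPolynomial.homogeneousSubmodule (Fin (d + 1 + 1)) K) {F} := by
      rw [ProjectiveSpectrum.mem_zeroLocus, hset, Set.singleton_subset_iff]
      exact hall F hiso
    rw [hrange]
    exact key
  obtain ⟨μ, hμ⟩ := hℓX
  refine ⟨μ, ⟨?_, L, hL, hhom, ?_⟩, fun G => ?_⟩
  · rw [← height_base_eq_of_isClosedImmersion' i.left μ, hμ, height_linearSubspacePoint]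
    congr 1
    omega
  · rw [← i.left.isClosedEmbedding.closure_image_eq, Set.image_singleton, hμ,
      closure_linearSubspacePoint]
  · rw [hμ, hℓI]
    exact ⟨fun hG => forall_eval_eq_zero_of_mem_span hvan hG, hall G⟩

include hrange in
/-- **From a linear-subspace point of `X` to its isotropic subspace.** For an `r`-plane point `z`
of `X` (`K` infinite) there is an `(r+1)`-dimensional subspace `W ⊆ K^{d+2}` on which `F` vanishes
and such that the homogeneous prime of `i z` consists exactly of the polynomials vanishing on `W`
(`W` is the common kernel of the `d + 1 - r` linear equations of `z`). [cite: Hartshorne1977, I Ex. 2.11] -/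
theorem exists_submodule_of_isLinearSubspacePoint [Infinite K] {r : ℕ} {z : ↥X.left}
    (hz : IsLinearSubspacePoint r (d + 1) i z) :
    ∃ W : Submodule K (Fin (d + 1 + 1) → K), Module.finrank K W = r + 1 ∧
      (∀ v ∈ W, MvPolynomial.eval v F = 0) ∧
      ∀ G : MvPolynomial (Fin (d + 1 + 1)) K,
        G ∈ (ProjectiveSpectrum.asHomogeneousIdeal (𝒜 := (MvPolynomial.homogeneousSubmodule (Fin (d + 1 + 1)) K)) (i.left.base z)).toIdeal ↔
          ∀ v ∈ W, MvPolynomial.eval v G = 0 := by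
  obtain ⟨L, hL, hhom, -, hspan, hr⟩ := hz.base_of_isClosedImmersion.exists_eq_span_of_id
  obtain ⟨w, hw, hker⟩ := exists_frame_of_linearIndependent_linearForms L hL hhom
  have hLW : ∀ j, ∀ v ∈ Submodule.span K (Set.range w), MvPolynomial.eval v (L j) = 0 := fun j =>
    forall_mem_span_eval_eq_zero_of_isHomogeneous_one (hhom j) (by
      rintro _ ⟨m, rfl⟩
      exact hker j m)
  -- `𝔭(i z) = (L) ⊆ {G | G|_{span w} = 0}`
  have hfwd : ∀ G : MvPolynomial (Fin (d + 1 + 1)) K,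
      G ∈ (ProjectiveSpectrum.asHomogeneousIdeal (𝒜 := (MvPolynomial.homogeneousSubmodule (Fin (d + 1 + 1)) K)) (i.left.base z)).toIdeal →
        ∀ v ∈ Submodule.span K (Set.range w), MvPolynomial.eval v G = 0 := by
    intro G hG
    rw [hspan] at hG
    exact forall_eval_eq_zero_of_mem_span hLW hG
  -- `F ∈ 𝔭(i z)`, so `span w` is isotropic
  have hFz : F ∈ (ProjectiveSpectrum.asHomogeneousIdeal
      (𝒜 := (MvPolynomial.homogeneousSubmodule (Fin (d + 1 + 1)) K)) (i.left.base z)).toIdeal := by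
    have h : i.left.base z ∈ Set.range i.left.base := ⟨z, rfl⟩
    rw [hrange] at h
    set P : ProjectiveSpectrum (MvPolynomial.homogeneousSubmodule (Fin (d + 1 + 1)) K) :=
      i.left.base z with hP
    have key : ({F} : Set (MvPolynomial (Fin (d + 1 + 1)) K)) ⊆
        (P.asHomogeneousIdeal : Set (MvPolynomial (Fin (d + 1 + 1)) K)) :=
      (ProjectiveSpectrum.mem_zeroLocus _ _ _).1 h
    exact Set.singleton_subset_iff.1 key
  have hiso : ∀ v ∈ Submodule.span K (Set.range w), MvPolynomial.eval v F = 0 := hfwd F hFz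
  -- the point of the frame `w` is `z`
  obtain ⟨μ, hμ, hμW⟩ := exists_isLinearSubspacePoint_of_frame i hrange (r := r)
    (m := d + 1 + 1 - (d + 1 - r)) (by omega) hr hw hiso
  have hzμ : i.left.base z ⤳ i.left.base μ :=
    specializes_iff_le.2 fun G hG => (hμW G).2 (hfwd G hG)
  have heq : i.left.base z = i.left.base μ := by
    refine eq_of_specializes_of_height_eq hzμ ?_ ?_
    · rw [height_base_eq_of_isClosedImmersion' i.left μ, height_base_eq_of_isClosedImmersion' i.left z,
        hμ.height_eq, hz.height_eq]
    · rw [height_base_eq_of_isClosedImmersion' i.left z, hz.height_eq]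
      exact WithTop.coe_lt_top _
  refine ⟨Submodule.span K (Set.range w), ?_, hiso, fun G => ?_⟩
  · rw [finrank_span_eq_card hw, Fintype.card_fin]
    omega
  · rw [heq]
    exact hμW G

/-- **Containment of subspaces is specialisation of points**: if the primes of `i μ` and `i z`
are the polynomials vanishing on `M` and on `W ≤ M` respectively, then `μ ⤳ z`. [folklore] -/
theorem specializes_of_submodule_le {μ z : ↥X.left} {W M : Submodule K (Fin (d + 1 + 1) → K)}
    (hWM : W ≤ M)
    (hμ : ∀ G : MvPolynomial (Fin (d + 1 + 1)) K,
      G ∈ (ProjectiveSpectrum.asHomogeneousIdeal (𝒜 := (MvPolynomial.homogeneousSubmodule (Fin (d + 1 + 1)) K)) (i.left.base μ)).toIdeal ↔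
        ∀ v ∈ M, MvPolynomial.eval v G = 0)
    (hz : ∀ G : MvPolynomial (Fin (d + 1 + 1)) K,
      G ∈ (ProjectiveSpectrum.asHomogeneousIdeal (𝒜 := (MvPolynomial.homogeneousSubmodule (Fin (d + 1 + 1)) K)) (i.left.base z)).toIdeal ↔
        ∀ v ∈ W, MvPolynomial.eval v G = 0) :
    μ ⤳ z := by
  have h : i.left.base μ ⤳ i.left.base z :=
    specializes_iff_le.2 fun G hG => (hz G).2 fun v hv => (hμ G).1 hG v (hWM hv)
  exact i.left.isClosedEmbedding.isInducing.specializes_iff.1 h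

/-- **A linear-subspace point is determined by its subspace.** [folklore] -/
theorem eq_of_submodule_eq {z z' : ↥X.left} {W : Submodule K (Fin (d + 1 + 1) → K)}
    (hz : ∀ G : MvPolynomial (Fin (d + 1 + 1)) K,
      G ∈ (ProjectiveSpectrum.asHomogeneousIdeal (𝒜 := (MvPolynomial.homogeneousSubmodule (Fin (d + 1 + 1)) K)) (i.left.base z)).toIdeal ↔
        ∀ v ∈ W, MvPolynomial.eval v G = 0)
    (hz' : ∀ G : MvPolynomial (Fin (d + 1 + 1)) K,
      G ∈ (ProjectiveSpectrum.asHomogeneousIdeal (𝒜 := (MvPolynomial.homogeneousSubmodule (Fin (d + 1 + 1)) K)) (i.left.base z')).toIdeal ↔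
        ∀ v ∈ W, MvPolynomial.eval v G = 0) :
    z = z' := by
  have h₁ : z ⤳ z' := specializes_of_submodule_le i le_rfl hz hz'
  have h₂ : z' ⤳ z := specializes_of_submodule_le i le_rfl hz' hz
  exact (h₁.antisymm h₂).eq

end Dictionary

/-! ### Two `s`-planes in a common isotropic `(s+2)`-subspace have the same class -/

section CommonSubspace

variable [Infinite K] {e : ℕ} [IsIntegral X.left] [LocallyOfFiniteType X.hom]
  (hF : F ∈ grading (Fin (d + 1 + 1)) K e) (hprime : Prime F)
  (hrange : Set.range i.left.base = ProjectiveSpectrum.zeroLocus (MvPolynomial.homogeneousSubmodule (Fin (d + 1 + 1)) K) {F})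

include hF hprime hrange in
/-- **Two `s`-planes of `X` whose subspaces lie in a common isotropic `(s+2)`-subspace `M` have the
same class in `CH_s(X)`**: `M` is an `(s+1)`-plane of `X` specialising to both
(`exists_isLinearSubspacePoint_of_frame`, `specializes_of_submodule_le`), and both are hyperplane
sections of it (`Hypersurface.ofPoint_eq_ofPoint_of_isLinearSubspacePoint`; Fulton, Example 2.5.1
with Cor. 2.4.2). [cite: Fulton1998, Example 2.5.1 (p. 41) and Cor. 2.4.2 (p. 38)] -/
theorem ofPoint_eq_ofPoint_of_le_isotropic (he : 2 ≤ e) {s : ℕ} (hs : s + 1 ≤ d + 1)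
    {z z' : ↥X.left} (hz : IsLinearSubspacePoint s (d + 1) i z)
    (hz' : IsLinearSubspacePoint s (d + 1) i z') {W W' M : Submodule K (Fin (d + 1 + 1) → K)}
    (hzW : ∀ G : MvPolynomial (Fin (d + 1 + 1)) K,
      G ∈ (ProjectiveSpectrum.asHomogeneousIdeal (𝒜 := (MvPolynomial.homogeneousSubmodule (Fin (d + 1 + 1)) K)) (i.left.base z)).toIdeal ↔
        ∀ v ∈ W, MvPolynomial.eval v G = 0)
    (hz'W' : ∀ G : MvPolynomial (Fin (d + 1 + 1)) K,
      G ∈ (ProjectiveSpectrum.asHomogeneousIdeal (𝒜 := (MvPolynomial.homogeneousSubmodule (Fin (d + 1 + 1)) K)) (i.left.base z')).toIdeal ↔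
        ∀ v ∈ W', MvPolynomial.eval v G = 0)
    (hWM : W ≤ M) (hW'M : W' ≤ M) (hM : Module.finrank K M = s + 2)
    (hMiso : ∀ v ∈ M, MvPolynomial.eval v F = 0) :
    ChowGroup.ofPoint z hz.height_eq = ChowGroup.ofPoint z' hz'.height_eq := by
  obtain ⟨m, hm, hspanM⟩ := exists_frame_of_finrank_eq hM
  obtain ⟨μ, hμ, hμM⟩ := exists_isLinearSubspacePoint_of_frame i hrange (r := s + 1) (m := s + 2)
    rfl hs hm (by rw [hspanM]; exact hMiso)
  rw [hspanM] at hμM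
  exact ofPoint_eq_ofPoint_of_isLinearSubspacePoint i hF hprime hrange he hμ hz hz'
    (specializes_of_submodule_le i hWM hμM hzW) (specializes_of_submodule_le i hW'M hμM hz'W')

end CommonSubspace

/-! ### Linear algebra of `S + Ky` -/

section SupSpan

omit [IsClosedImmersion i.left]

/-- `dim (S + Ky) = dim S + 1` for `y ∉ S` — this is Mathlib's `Submodule.finrank_sup_span_singleton`
(`Mathlib/LinearAlgebra/FiniteDimensional/Lemmas.lean`); kept as a deprecated alias (librarian
dedup-01437). [folklore] -/
@[deprecated Submodule.finrank_sup_span_singleton (since := "2026-08-16")]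
alias finrank_sup_span_singleton_of_notMem := Submodule.finrank_sup_span_singleton

/-- A property of all `w + t • y`, `w ∈ S`, holds on `S + Ky`. [folklore] -/
theorem forall_mem_sup_span_singleton {S : Submodule K (Fin (d + 1 + 1) → K)}
    {y : Fin (d + 1 + 1) → K} {P : (Fin (d + 1 + 1) → K) → Prop}
    (h : ∀ w ∈ S, ∀ t : K, P (w + t • y)) : ∀ v ∈ S ⊔ Submodule.span K {y}, P v := by
  intro v hv
  obtain ⟨w, hw, u, hu, rfl⟩ := Submodule.mem_sup.1 hv
  obtain ⟨t, rfl⟩ := Submodule.mem_span_singleton.1 hu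
  exact h w hw t

/-- A strict inequality of subspaces from their dimensions. [folklore] -/
theorem inf_lt_of_finrank_lt {W₁ W₂ : Submodule K (Fin (d + 1 + 1) → K)}
    (h : Module.finrank K ↥(W₁ ⊓ W₂) < Module.finrank K W₁) : W₁ ⊓ W₂ < W₁ := by
  refine lt_of_le_of_ne inf_le_left fun heq => ?_
  have : Module.finrank K ↥(W₁ ⊓ W₂) = Module.finrank K ↥W₁ := by rw [heq]
  omega

end SupSpan

/-! ### The chain argument for cubics -/

section Chain

variable [IsAlgClosed K] [IsIntegral X.left] [LocallyOfFiniteType X.hom]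
  (hF : F ∈ grading (Fin (d + 1 + 1)) K 3) (hprime : Prime F)
  (hrange : Set.range i.left.base =
    ProjectiveSpectrum.zeroLocus (MvPolynomial.homogeneousSubmodule (Fin (d + 1 + 1)) K) {F})
  (hd : 15 ≤ d)

include hF hprime hrange hd in
/-- **Two planes of `X` whose subspaces meet in dimension `≥ 2` have the same class** (`d ≥ 15`):
either the subspaces coincide (and so do the points), or they are two `3`-spaces `W₁, W₂` through a
common `2`-space `U`, and a common vector `y` with `W₁ + Ky`, `W₂ + Ky` isotropic
(`exists_common_isotropic_extension`, `14 + 2 < d + 2`) gives the chain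
`W₁ ⊆ W₁ + Ky ⊇ U + Ky ⊆ W₂ + Ky ⊇ W₂`. [folklore] -/
theorem ofPoint_eq_of_two_le_finrank_inf {z₁ z₂ : ↥X.left}
    (hz₁ : IsLinearSubspacePoint 2 (d + 1) i z₁) (hz₂ : IsLinearSubspacePoint 2 (d + 1) i z₂)
    {W₁ W₂ : Submodule K (Fin (d + 1 + 1) → K)} (h₁ : Module.finrank K W₁ = 3)
    (h₂ : Module.finrank K W₂ = 3) (hiso₁ : ∀ v ∈ W₁, MvPolynomial.eval v F = 0)
    (hiso₂ : ∀ v ∈ W₂, MvPolynomial.eval v F = 0)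
    (hA₁ : ∀ G : MvPolynomial (Fin (d + 1 + 1)) K,
      G ∈ (ProjectiveSpectrum.asHomogeneousIdeal
        (𝒜 := (MvPolynomial.homogeneousSubmodule (Fin (d + 1 + 1)) K)) (i.left.base z₁)).toIdeal ↔
        ∀ v ∈ W₁, MvPolynomial.eval v G = 0)
    (hA₂ : ∀ G : MvPolynomial (Fin (d + 1 + 1)) K,
      G ∈ (ProjectiveSpectrum.asHomogeneousIdeal
        (𝒜 := (MvPolynomial.homogeneousSubmodule (Fin (d + 1 + 1)) K)) (i.left.base z₂)).toIdeal ↔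
        ∀ v ∈ W₂, MvPolynomial.eval v G = 0)
    (h₁₂ : 2 ≤ Module.finrank K ↥(W₁ ⊓ W₂)) :
    ChowGroup.ofPoint z₁ hz₁.height_eq = ChowGroup.ofPoint z₂ hz₂.height_eq := by
  haveI : Infinite K := IsAlgClosed.instInfinite
  have hF3 : F.IsHomogeneous 3 := (MvPolynomial.mem_homogeneousSubmodule 3 F).1 hF
  have hle3 : Module.finrank K ↥(W₁ ⊓ W₂) ≤ 3 := h₁ ▸ Submodule.finrank_mono inf_le_left
  rcases Nat.lt_or_ge (Module.finrank K ↥(W₁ ⊓ W₂)) 3 with hlt | hge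
  · -- two `3`-spaces through a common `2`-space `U`: a common `y ∉ U` with `W_a + Ky` isotropic
    have h2 : Module.finrank K ↥(W₁ ⊓ W₂) = 2 := by omega
    obtain ⟨y, hyU, hy₁, hy₂⟩ := exists_common_isotropic_extension_inf hF3 (d := 2) h₁ h₂ h2 hiso₁
      hiso₂ (by
        change (Finset.univ.filter (fun f : Fin 4 → Fin 3 =>
          ∑ j, (f j : ℕ) ≤ 2 ∧ (f 1 = 0 ∨ f 0 = 0))).card + 2 < d + 1 + 1
        rw [card_filter_fin_four_or]
        omega)
    have hQ : Module.finrank K ↥((W₁ ⊓ W₂) ⊔ Submodule.span K {y}) = 3 := by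
      rw [Submodule.finrank_sup_span_singleton hyU, h2]
    have hM₁iso : ∀ v ∈ W₁ ⊔ Submodule.span K {y}, MvPolynomial.eval v F = 0 :=
      forall_mem_sup_span_singleton hy₁
    have hM₂iso : ∀ v ∈ W₂ ⊔ Submodule.span K {y}, MvPolynomial.eval v F = 0 :=
      forall_mem_sup_span_singleton hy₂
    have hQM₁ : (W₁ ⊓ W₂) ⊔ Submodule.span K {y} ≤ W₁ ⊔ Submodule.span K {y} :=
      sup_le_sup_right inf_le_left _
    have hQM₂ : (W₁ ⊓ W₂) ⊔ Submodule.span K {y} ≤ W₂ ⊔ Submodule.span K {y} :=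
      sup_le_sup_right inf_le_right _
    -- the plane point of `Q = U + Ky`
    obtain ⟨q₀, hq₀, hspanQ⟩ := exists_frame_of_finrank_eq hQ
    obtain ⟨q, hq, hqQ⟩ := exists_isLinearSubspacePoint_of_frame i hrange (r := 2) (m := 3) rfl
      (by omega) hq₀ (by rw [hspanQ]; exact fun v hv => hM₁iso v (hQM₁ hv))
    rw [hspanQ] at hqQ
    -- the links `W₁ ~ Q` and `Q ~ W₂`: inside the `4`-space `W_a + Ky`, or `Q = W_a` if `y ∈ W_a`
    have link₁ : ChowGroup.ofPoint z₁ hz₁.height_eq = ChowGroup.ofPoint q hq.height_eq := by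
      by_cases hyW₁ : y ∈ W₁
      · have hQW₁ : (W₁ ⊓ W₂) ⊔ Submodule.span K {y} ≤ W₁ :=
          sup_le inf_le_left ((Submodule.span_singleton_le_iff_mem _ _).2 hyW₁)
        have hQeq : (W₁ ⊓ W₂) ⊔ Submodule.span K {y} = W₁ :=
          Submodule.eq_of_le_of_finrank_eq hQW₁ (by rw [hQ, h₁])
        have hqW₁ := hqQ
        rw [hQeq] at hqW₁
        have hzq : z₁ = q := eq_of_submodule_eq i hA₁ hqW₁
        subst hzq
        rfl
      · have hM₁ : Module.finrank K ↥(W₁ ⊔ Submodule.span K {y}) = 2 + 2 := by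
          rw [Submodule.finrank_sup_span_singleton hyW₁, h₁]
        exact ofPoint_eq_ofPoint_of_le_isotropic i hF hprime hrange (by norm_num) (by omega) hz₁ hq
          hA₁ hqQ le_sup_left hQM₁ hM₁ hM₁iso
    have link₂ : ChowGroup.ofPoint q hq.height_eq = ChowGroup.ofPoint z₂ hz₂.height_eq := by
      by_cases hyW₂ : y ∈ W₂
      · have hQW₂ : (W₁ ⊓ W₂) ⊔ Submodule.span K {y} ≤ W₂ :=
          sup_le inf_le_right ((Submodule.span_singleton_le_iff_mem _ _).2 hyW₂)
        have hQeq : (W₁ ⊓ W₂) ⊔ Submodule.span K {y} = W₂ :=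
          Submodule.eq_of_le_of_finrank_eq hQW₂ (by rw [hQ, h₂])
        have hqW₂ := hqQ
        rw [hQeq] at hqW₂
        have hzq : z₂ = q := eq_of_submodule_eq i hA₂ hqW₂
        subst hzq
        rfl
      · have hM₂ : Module.finrank K ↥(W₂ ⊔ Submodule.span K {y}) = 2 + 2 := by
          rw [Submodule.finrank_sup_span_singleton hyW₂, h₂]
        exact ofPoint_eq_ofPoint_of_le_isotropic i hF hprime hrange (by norm_num) (by omega) hq hz₂
          hqQ hA₂ hQM₂ le_sup_left hM₂ hM₂iso
    exact link₁.trans link₂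
  · -- `W₁ = W₂`, hence `z₁ = z₂`
    have heq₁ : W₁ ⊓ W₂ = W₁ := Submodule.eq_of_le_of_finrank_eq inf_le_left (by omega)
    have heq₂ : W₁ ⊓ W₂ = W₂ := Submodule.eq_of_le_of_finrank_eq inf_le_right (by omega)
    have hW : W₁ = W₂ := heq₁.symm.trans heq₂
    subst hW
    have hz : z₁ = z₂ := eq_of_submodule_eq i hA₁ hA₂
    subst hz
    rfl

include hF hprime hrange hd in
/-- **Two planes of `X` whose subspaces meet in dimension `≥ 1` have the same class** (`d ≥ 15`):
for a common point `p`, lines `ℓ₁ ∋ p` of the first and `ℓ₂ ∋ p` of the second plane lie in planes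
`ℓ₁ + Kw`, `ℓ₂ + Kw` of `X` with a common `w` (`exists_common_isotropic_extension`,
`9 + 3 < d + 2`), and consecutive members of `W₁, ℓ₁ + Kw, ℓ₂ + Kw, W₂` meet in dimension `2`.
[folklore] -/
theorem ofPoint_eq_of_one_le_finrank_inf {z₁ z₂ : ↥X.left}
    (hz₁ : IsLinearSubspacePoint 2 (d + 1) i z₁) (hz₂ : IsLinearSubspacePoint 2 (d + 1) i z₂)
    {W₁ W₂ : Submodule K (Fin (d + 1 + 1) → K)} (h₁ : Module.finrank K W₁ = 3)
    (h₂ : Module.finrank K W₂ = 3) (hiso₁ : ∀ v ∈ W₁, MvPolynomial.eval v F = 0)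
    (hiso₂ : ∀ v ∈ W₂, MvPolynomial.eval v F = 0)
    (hA₁ : ∀ G : MvPolynomial (Fin (d + 1 + 1)) K,
      G ∈ (ProjectiveSpectrum.asHomogeneousIdeal
        (𝒜 := (MvPolynomial.homogeneousSubmodule (Fin (d + 1 + 1)) K)) (i.left.base z₁)).toIdeal ↔
        ∀ v ∈ W₁, MvPolynomial.eval v G = 0)
    (hA₂ : ∀ G : MvPolynomial (Fin (d + 1 + 1)) K,
      G ∈ (ProjectiveSpectrum.asHomogeneousIdeal
        (𝒜 := (MvPolynomial.homogeneousSubmodule (Fin (d + 1 + 1)) K)) (i.left.base z₂)).toIdeal ↔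
        ∀ v ∈ W₂, MvPolynomial.eval v G = 0)
    (h₁₂ : 1 ≤ Module.finrank K ↥(W₁ ⊓ W₂)) :
    ChowGroup.ofPoint z₁ hz₁.height_eq = ChowGroup.ofPoint z₂ hz₂.height_eq := by
  haveI : Infinite K := IsAlgClosed.instInfinite
  by_cases htwo : 2 ≤ Module.finrank K ↥(W₁ ⊓ W₂)
  · exact ofPoint_eq_of_two_le_finrank_inf i hF hprime hrange hd hz₁ hz₂ h₁ h₂ hiso₁ hiso₂ hA₁ hA₂
      htwo
  have hF3 : F.IsHomogeneous 3 := (MvPolynomial.mem_homogeneousSubmodule 3 F).1 hF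
  have hU : Module.finrank K ↥(W₁ ⊓ W₂) = 1 := by omega
  -- `y₁ ∈ W₁ ∖ U`, `y₂ ∈ W₂ ∖ U` and the lines `ℓ_a = U + K y_a`
  obtain ⟨y₁, hy₁W, hy₁U⟩ := SetLike.exists_of_lt (inf_lt_of_finrank_lt (W₁ := W₁) (W₂ := W₂)
    (by omega))
  obtain ⟨y₂, hy₂W, hy₂U⟩ := SetLike.exists_of_lt (inf_lt_of_finrank_lt (W₁ := W₂) (W₂ := W₁)
    (by rw [inf_comm]; omega))
  rw [inf_comm] at hy₂U
  set U := W₁ ⊓ W₂ with hU_def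
  have hℓ₁ : Module.finrank K ↥(U ⊔ Submodule.span K {y₁}) = 1 + 1 := by
    rw [Submodule.finrank_sup_span_singleton hy₁U, hU]
  have hℓ₂ : Module.finrank K ↥(U ⊔ Submodule.span K {y₂}) = 1 + 1 := by
    rw [Submodule.finrank_sup_span_singleton hy₂U, hU]
  have hℓ₁W₁ : U ⊔ Submodule.span K {y₁} ≤ W₁ :=
    sup_le inf_le_left ((Submodule.span_singleton_le_iff_mem _ _).2 hy₁W)
  have hℓ₂W₂ : U ⊔ Submodule.span K {y₂} ≤ W₂ :=
    sup_le inf_le_right ((Submodule.span_singleton_le_iff_mem _ _).2 hy₂W)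
  have hℓℓ : (U ⊔ Submodule.span K {y₁}) ⊓ (U ⊔ Submodule.span K {y₂}) = U :=
    le_antisymm (inf_le_inf hℓ₁W₁ hℓ₂W₂) (le_inf le_sup_left le_sup_left)
  have hℓfin : Module.finrank K ↥((U ⊔ Submodule.span K {y₁}) ⊓ (U ⊔ Submodule.span K {y₂})) =
      1 := by
    rw [hℓℓ, hU]
  have hℓ₁iso : ∀ v ∈ U ⊔ Submodule.span K {y₁}, MvPolynomial.eval v F = 0 :=
    fun v hv => hiso₁ v (hℓ₁W₁ hv)
  have hℓ₂iso : ∀ v ∈ U ⊔ Submodule.span K {y₂}, MvPolynomial.eval v F = 0 :=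
    fun v hv => hiso₂ v (hℓ₂W₂ hv)
  -- a common vector `w` with `ℓ₁ + Kw`, `ℓ₂ + Kw` isotropic
  obtain ⟨w, hw, hw₁, hw₂⟩ := exists_common_isotropic_extension hF3 (d := 1) hℓ₁ hℓ₂ hℓfin hℓ₁iso
    hℓ₂iso (by
      change (Finset.univ.filter (fun f : Fin 3 → Fin 3 =>
        ∑ j, (f j : ℕ) ≤ 2 ∧ (f 1 = 0 ∨ f 0 = 0))).card + 3 < d + 1 + 1
      rw [card_filter_fin_three_or]
      omega)
  have hwℓ₁ : w ∉ U ⊔ Submodule.span K {y₁} := fun h => hw (Submodule.mem_sup_left h)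
  have hwℓ₂ : w ∉ U ⊔ Submodule.span K {y₂} := fun h => hw (Submodule.mem_sup_right h)
  have hwU : w ∉ U := fun h => hwℓ₁ (Submodule.mem_sup_left h)
  have hQ₁ : Module.finrank K ↥((U ⊔ Submodule.span K {y₁}) ⊔ Submodule.span K {w}) = 3 := by
    rw [Submodule.finrank_sup_span_singleton hwℓ₁, hℓ₁]
  have hQ₂ : Module.finrank K ↥((U ⊔ Submodule.span K {y₂}) ⊔ Submodule.span K {w}) = 3 := by
    rw [Submodule.finrank_sup_span_singleton hwℓ₂, hℓ₂]
  have hQ₁iso : ∀ v ∈ (U ⊔ Submodule.span K {y₁}) ⊔ Submodule.span K {w},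
      MvPolynomial.eval v F = 0 := forall_mem_sup_span_singleton hw₁
  have hQ₂iso : ∀ v ∈ (U ⊔ Submodule.span K {y₂}) ⊔ Submodule.span K {w},
      MvPolynomial.eval v F = 0 := forall_mem_sup_span_singleton hw₂
  -- the plane points of `Q₁`, `Q₂`
  obtain ⟨f₁, hf₁, hspan₁⟩ := exists_frame_of_finrank_eq hQ₁
  obtain ⟨q₁, hq₁, hq₁Q⟩ := exists_isLinearSubspacePoint_of_frame i hrange (r := 2) (m := 3) rfl
    (by omega) hf₁ (by rw [hspan₁]; exact hQ₁iso)
  rw [hspan₁] at hq₁Q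
  obtain ⟨f₂, hf₂, hspan₂⟩ := exists_frame_of_finrank_eq hQ₂
  obtain ⟨q₂, hq₂, hq₂Q⟩ := exists_isLinearSubspacePoint_of_frame i hrange (r := 2) (m := 3) rfl
    (by omega) hf₂ (by rw [hspan₂]; exact hQ₂iso)
  rw [hspan₂] at hq₂Q
  -- the three links, each between subspaces meeting in dimension `2`
  have e₁ := ofPoint_eq_of_two_le_finrank_inf i hF hprime hrange hd hz₁ hq₁ h₁ hQ₁ hiso₁ hQ₁iso hA₁
    hq₁Q (by
      have hmono := Submodule.finrank_mono (R := K) (le_inf hℓ₁W₁ (le_sup_left (b := Submodule.span K {w})))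
      omega)
  have e₂ := ofPoint_eq_of_two_le_finrank_inf i hF hprime hrange hd hq₁ hq₂ hQ₁ hQ₂ hQ₁iso hQ₂iso
    hq₁Q hq₂Q (by
      have h2 : Module.finrank K ↥(U ⊔ Submodule.span K {w}) = 1 + 1 := by
        rw [Submodule.finrank_sup_span_singleton hwU, hU]
      have hmono := Submodule.finrank_mono (R := K)
        (le_inf (sup_le (le_sup_left.trans le_sup_left) le_sup_right)
          (sup_le (le_sup_left.trans le_sup_left) le_sup_right) :
          U ⊔ Submodule.span K {w} ≤
            ((U ⊔ Submodule.span K {y₁}) ⊔ Submodule.span K {w}) ⊓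
              ((U ⊔ Submodule.span K {y₂}) ⊔ Submodule.span K {w}))
      omega)
  have e₃ := ofPoint_eq_of_two_le_finrank_inf i hF hprime hrange hd hq₂ hz₂ hQ₂ h₂ hQ₂iso hiso₂ hq₂Q
    hA₂ (by
      have hmono := Submodule.finrank_mono (R := K) (le_inf (le_sup_left (b := Submodule.span K {w})) hℓ₂W₂)
      omega)
  exact e₁.trans (e₂.trans e₃)

include hF hprime hrange hd in
/-- **Any two planes of `X` have the same class** (`d ≥ 15`): for points `p₁, p₂` of the two
planes, a common `y` with isotropic lines `Kp₁ + Ky`, `Kp₂ + Ky` (`5 + 2 < d + 2`), planes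
`Q₁ ⊇ Kp₁ + Ky`, `Q₂ ⊇ Kp₂ + Ky` of `X` (`6 + 2 < d + 2`), and the chain `W₁, Q₁, Q₂, W₂`, whose
consecutive members meet in dimension `≥ 1`. [folklore] -/
theorem ofPoint_eq_of_cubic {z₁ z₂ : ↥X.left}
    (hz₁ : IsLinearSubspacePoint 2 (d + 1) i z₁) (hz₂ : IsLinearSubspacePoint 2 (d + 1) i z₂)
    {W₁ W₂ : Submodule K (Fin (d + 1 + 1) → K)} (h₁ : Module.finrank K W₁ = 3)
    (h₂ : Module.finrank K W₂ = 3) (hiso₁ : ∀ v ∈ W₁, MvPolynomial.eval v F = 0)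
    (hiso₂ : ∀ v ∈ W₂, MvPolynomial.eval v F = 0)
    (hA₁ : ∀ G : MvPolynomial (Fin (d + 1 + 1)) K,
      G ∈ (ProjectiveSpectrum.asHomogeneousIdeal
        (𝒜 := (MvPolynomial.homogeneousSubmodule (Fin (d + 1 + 1)) K)) (i.left.base z₁)).toIdeal ↔
        ∀ v ∈ W₁, MvPolynomial.eval v G = 0)
    (hA₂ : ∀ G : MvPolynomial (Fin (d + 1 + 1)) K,
      G ∈ (ProjectiveSpectrum.asHomogeneousIdeal
        (𝒜 := (MvPolynomial.homogeneousSubmodule (Fin (d + 1 + 1)) K)) (i.left.base z₂)).toIdeal ↔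
        ∀ v ∈ W₂, MvPolynomial.eval v G = 0) :
    ChowGroup.ofPoint z₁ hz₁.height_eq = ChowGroup.ofPoint z₂ hz₂.height_eq := by
  haveI : Infinite K := IsAlgClosed.instInfinite
  by_cases hone : 1 ≤ Module.finrank K ↥(W₁ ⊓ W₂)
  · exact ofPoint_eq_of_one_le_finrank_inf i hF hprime hrange hd hz₁ hz₂ h₁ h₂ hiso₁ hiso₂ hA₁ hA₂
      hone
  have hF3 : F.IsHomogeneous 3 := (MvPolynomial.mem_homogeneousSubmodule 3 F).1 hF
  have h0 : W₁ ⊓ W₂ = ⊥ := Submodule.finrank_eq_zero.1 (by omega)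
  -- nonzero `p₁ ∈ W₁`, `p₂ ∈ W₂`
  have hW₁ne : W₁ ≠ ⊥ := fun h => by rw [h, finrank_bot] at h₁; omega
  have hW₂ne : W₂ ≠ ⊥ := fun h => by rw [h, finrank_bot] at h₂; omega
  obtain ⟨p₁, hp₁W, hp₁0⟩ := Submodule.exists_mem_ne_zero_of_ne_bot hW₁ne
  obtain ⟨p₂, hp₂W, hp₂0⟩ := Submodule.exists_mem_ne_zero_of_ne_bot hW₂ne
  have hP₁ : Module.finrank K ↥(Submodule.span K {p₁}) = 0 + 1 := by
    rw [finrank_span_singleton hp₁0]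
  have hP₂ : Module.finrank K ↥(Submodule.span K {p₂}) = 0 + 1 := by
    rw [finrank_span_singleton hp₂0]
  have hP₁W₁ : Submodule.span K {p₁} ≤ W₁ := (Submodule.span_singleton_le_iff_mem _ _).2 hp₁W
  have hP₂W₂ : Submodule.span K {p₂} ≤ W₂ := (Submodule.span_singleton_le_iff_mem _ _).2 hp₂W
  have hPP : Submodule.span K {p₁} ⊓ Submodule.span K {p₂} = ⊥ :=
    eq_bot_iff.2 (h0 ▸ inf_le_inf hP₁W₁ hP₂W₂)
  have hPPfin : Module.finrank K ↥(Submodule.span K {p₁} ⊓ Submodule.span K {p₂}) = 0 := by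
    rw [hPP, finrank_bot]
  have hP₁iso : ∀ v ∈ Submodule.span K {p₁}, MvPolynomial.eval v F = 0 :=
    fun v hv => hiso₁ v (hP₁W₁ hv)
  have hP₂iso : ∀ v ∈ Submodule.span K {p₂}, MvPolynomial.eval v F = 0 :=
    fun v hv => hiso₂ v (hP₂W₂ hv)
  -- a common `y` with isotropic lines `Kp₁ + Ky`, `Kp₂ + Ky`
  obtain ⟨y, hy, hy₁, hy₂⟩ := exists_common_isotropic_extension hF3 (d := 0) hP₁ hP₂ hPPfin hP₁iso
    hP₂iso (by
      change (Finset.univ.filter (fun f : Fin 2 → Fin 3 =>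
        ∑ j, (f j : ℕ) ≤ 2 ∧ (f 1 = 0 ∨ f 0 = 0))).card + 2 < d + 1 + 1
      rw [card_filter_fin_two_or]
      omega)
  have hy0 : y ≠ 0 := fun h => hy (h ▸ Submodule.zero_mem _)
  have hyP₁ : y ∉ Submodule.span K {p₁} := fun h => hy (Submodule.mem_sup_left h)
  have hyP₂ : y ∉ Submodule.span K {p₂} := fun h => hy (Submodule.mem_sup_right h)
  have hL₁ : Module.finrank K ↥(Submodule.span K {p₁} ⊔ Submodule.span K {y}) ≤ 2 := by
    rw [Submodule.finrank_sup_span_singleton hyP₁, hP₁]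
  have hL₂ : Module.finrank K ↥(Submodule.span K {p₂} ⊔ Submodule.span K {y}) ≤ 2 := by
    rw [Submodule.finrank_sup_span_singleton hyP₂, hP₂]
  -- planes `Q₁ ⊇ Kp₁ + Ky`, `Q₂ ⊇ Kp₂ + Ky` of `X`
  obtain ⟨Q₁, hLQ₁, hQ₁, hQ₁iso⟩ := exists_isotropic_finrank_three_ge (N := d + 1) (by omega) hF3 hL₁
    (forall_mem_sup_span_singleton hy₁)
  obtain ⟨Q₂, hLQ₂, hQ₂, hQ₂iso⟩ := exists_isotropic_finrank_three_ge (N := d + 1) (by omega) hF3 hL₂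
    (forall_mem_sup_span_singleton hy₂)
  obtain ⟨f₁, hf₁, hspan₁⟩ := exists_frame_of_finrank_eq hQ₁
  obtain ⟨q₁, hq₁, hq₁Q⟩ := exists_isLinearSubspacePoint_of_frame i hrange (r := 2) (m := 3) rfl
    (by omega) hf₁ (by rw [hspan₁]; exact hQ₁iso)
  rw [hspan₁] at hq₁Q
  obtain ⟨f₂, hf₂, hspan₂⟩ := exists_frame_of_finrank_eq hQ₂
  obtain ⟨q₂, hq₂, hq₂Q⟩ := exists_isLinearSubspacePoint_of_frame i hrange (r := 2) (m := 3) rfl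
    (by omega) hf₂ (by rw [hspan₂]; exact hQ₂iso)
  rw [hspan₂] at hq₂Q
  -- the three links, each between subspaces meeting in dimension `≥ 1`
  have e₁ := ofPoint_eq_of_one_le_finrank_inf i hF hprime hrange hd hz₁ hq₁ h₁ hQ₁ hiso₁ hQ₁iso hA₁
    hq₁Q (by
      have hmono := Submodule.finrank_mono (R := K) (le_inf hP₁W₁ (le_sup_left.trans hLQ₁))
      have h1 := finrank_span_singleton (K := K) hp₁0
      omega)
  have e₂ := ofPoint_eq_of_one_le_finrank_inf i hF hprime hrange hd hq₁ hq₂ hQ₁ hQ₂ hQ₁iso hQ₂iso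
    hq₁Q hq₂Q (by
      have hmono := Submodule.finrank_mono (R := K)
        (le_inf (le_sup_right.trans hLQ₁) (le_sup_right.trans hLQ₂) :
          Submodule.span K {y} ≤ Q₁ ⊓ Q₂)
      have h1 := finrank_span_singleton (K := K) hy0
      omega)
  have e₃ := ofPoint_eq_of_one_le_finrank_inf i hF hprime hrange hd hq₂ hz₂ hQ₂ h₂ hQ₂iso hiso₂ hq₂Q
    hA₂ (by
      have hmono := Submodule.finrank_mono (R := K) (le_inf (le_sup_left.trans hLQ₂) hP₂W₂)
      have h1 := finrank_span_singleton (K := K) hp₂0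
      omega)
  exact e₁.trans (e₂.trans e₃)

include hF hprime hrange hd in
/-- **Any two planes of a cubic hypersurface of dimension `d ≥ 15` have the same class in
`CH₂(X)`** (`X = V₊(F) ⊆ ℙ^{d+1}` integral, `F` a prime cubic form, `K` algebraically closed; no
smoothness). [folklore] -/
theorem ofPoint_eq_ofPoint_of_isLinearSubspacePoint_two {z₁ z₂ : ↥X.left}
    (hz₁ : IsLinearSubspacePoint 2 (d + 1) i z₁) (hz₂ : IsLinearSubspacePoint 2 (d + 1) i z₂) :
    ChowGroup.ofPoint z₁ hz₁.height_eq = ChowGroup.ofPoint z₂ hz₂.height_eq := by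
  haveI : Infinite K := IsAlgClosed.instInfinite
  obtain ⟨W₁, h₁, hiso₁, hA₁⟩ := exists_submodule_of_isLinearSubspacePoint i hrange hz₁
  obtain ⟨W₂, h₂, hiso₂, hA₂⟩ := exists_submodule_of_isLinearSubspacePoint i hrange hz₂
  exact ofPoint_eq_of_cubic i hF hprime hrange hd hz₁ hz₂ h₁ h₂ hiso₁ hiso₂ hA₁ hA₂

end Chain

/-! ### Input (b) of `Mboro2018_chowTwo_cubic_of_inputs` for `n ≥ 15`, and clause (ii) from (i) -/

section Inputs

/-- **Input (b) of `Mboro2018_chowTwo_cubic_of_inputs` in the range `n ≥ 15`**, in its binder shape: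
for a smooth cubic `n`-fold `X ⊆ ℙⁿ⁺¹_k` over an algebraically closed field (of any
characteristic), `n ≥ 15`, any two planes of `X` have rationally equivalent prime cycles. (The
printed range is `n ≥ 9`, via `CH₀(F₂(X)) ≅ ℤ`; here the elementary chain argument.)
[cite: Mboro2018, Cor. 2.9 (ii) (arXiv:1701.04488 p. 12)] -/
theorem isRationallyEquivalent_of_isLinearSubspacePoint_two {k : Type u} [Field k] [IsAlgClosed k]
    (n : ℕ) {X : SchemeOver k} (F : MvPolynomial (Fin (n + 1 + 1)) k)
    (i : X ⟶ projectiveSpace (n + 1) k) (hX : IsSmoothProjective n X) (hF : F.IsHomogeneous 3)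
    (hirr : Irreducible F) [IsClosedImmersion i.left]
    (hV : Set.range i.left.base =
      ProjectiveSpectrum.zeroLocus (MvPolynomial.homogeneousSubmodule (Fin (n + 1 + 1)) k) {F})
    (hn : 15 ≤ n) ⦃z z' : ↥X.left⦄ (hz : IsLinearSubspacePoint 2 (n + 1) i z)
    (hz' : IsLinearSubspacePoint 2 (n + 1) i z') :
    IsRationallyEquivalent (primeCycle z) (primeCycle z') 2 := by
  haveI : IsIntegral X.left := IsSmoothProjective.isIntegral_holds hX
  have := hX.smoothOfRelativeDimension
  have : Smooth X.hom := SmoothOfRelativeDimension.smooth n X.hom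
  haveI : LocallyOfFiniteType X.hom := inferInstance
  exact ChowGroup.isRationallyEquivalent_of_ofPoint_eq hz.height_eq hz'.height_eq
    (ofPoint_eq_ofPoint_of_isLinearSubspacePoint_two i ((MvPolynomial.mem_homogeneousSubmodule 3 F).2 hF)
      (UniqueFactorizationMonoid.irreducible_iff_prime.mp hirr) hV hn hz hz')

/-- **Clause (ii) of Mboro's Cor. 2.9 from clause (i) alone, for `n ≥ 15`**: if the planes of a
smooth cubic `n`-fold `X ⊆ ℙⁿ⁺¹_k` (`k` algebraically closed, `n ≥ 15`) generate `CH₂(X)`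
(`ChowGeneratedByLinearSubspaces 2 (n + 1) i`, e.g. from `Mboro2018_chowTwo_cubic` (i)), then
`CH₂(X) ≃ ℤ`: all plane classes coincide (`isRationallyEquivalent_of_isLinearSubspacePoint_two`),
planes exist (`exists_isLinearSubspacePoint_two_of_cubic`) and are non-torsion
(`IsLinearSubspacePoint.nsmul_primeCycle_notMem_ratTrivial_of_id`, degree), and the glue
`ChowGeneratedByLinearSubspaces.nonempty_addEquiv_int_of_primeCycle` applies.
[cite: Mboro2018, Cor. 2.9 (ii) (arXiv:1701.04488 p. 12)] -/
theorem nonempty_addEquiv_int_of_chowGeneratedByPlanes {k : Type u} [Field k] [IsAlgClosed k]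
    (n : ℕ) {X : SchemeOver k} (F : MvPolynomial (Fin (n + 1 + 1)) k)
    (i : X ⟶ projectiveSpace (n + 1) k) (hX : IsSmoothProjective n X) (hF : F.IsHomogeneous 3)
    (hirr : Irreducible F) [IsClosedImmersion i.left]
    (hV : Set.range i.left.base =
      ProjectiveSpectrum.zeroLocus (MvPolynomial.homogeneousSubmodule (Fin (n + 1 + 1)) k) {F})
    (hn : 15 ≤ n) (hgen : ChowGeneratedByLinearSubspaces 2 (n + 1) i) :
    Nonempty (ChowGroup X.left 2 ≃+ ℤ) := by
  haveI : Infinite k := IsAlgClosed.instInfinite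
  obtain ⟨z₀, hz₀⟩ := exists_isLinearSubspacePoint_two_of_cubic (N := n + 1) (by omega) F hF i hV
  exact hgen.nonempty_addEquiv_int_of_primeCycle
    (isRationallyEquivalent_of_isLinearSubspacePoint_two n F i hX hF hirr hV hn) hz₀
    fun m hm => IsLinearSubspacePoint.nsmul_primeCycle_notMem_ratTrivial_of_projectiveSpace
      (fun m' hm' => hz₀.base_of_isClosedImmersion.nsmul_primeCycle_notMem_ratTrivial_of_id hm') hm

/-- **Mboro's Cor. 2.9 for `n ≥ 15` from input (a) alone.** Granting input (a) of
`Mboro2018_chowTwo_cubic_of_inputs` (every irreducible surface of a smooth cubic `n`-fold, `n ≥ 7`,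
is rationally equivalent to an integral combination of planes — Prop. 1.4 + Thm. 2.8 in print), both
clauses of `Mboro2018_chowTwo_cubic` hold for every smooth cubic `n`-fold with `n ≥ 15`: (i) by the
prime-cycle reduction `ChowGeneratedByLinearSubspaces.of_primeCycle`, (ii) by
`nonempty_addEquiv_int_of_chowGeneratedByPlanes`. What input (b) still has to supply for the fact
itself is the range `9 ≤ n ≤ 14`. [cite: Mboro2018, Cor. 2.9 (arXiv:1701.04488 p. 12)] -/
theorem chowTwo_cubic_of_input_a_of_fifteen_le
    (ha : ∀ ⦃k : Type u⦄ [Field k] [IsAlgClosed k] [CharZero k] (n : ℕ) ⦃X : SchemeOver k⦄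
      (F : MvPolynomial (Fin (n + 1 + 1)) k) (i : X ⟶ projectiveSpace (n + 1) k),
      letI := MvPolynomial.gradedAlgebra (σ := Fin (n + 1 + 1)) (R := k)
      IsSmoothProjective n X → F.IsHomogeneous 3 → Irreducible F → IsClosedImmersion i.left →
        Set.range i.left.base =
          ProjectiveSpectrum.zeroLocus (MvPolynomial.homogeneousSubmodule (Fin (n + 1 + 1)) k)
            {F} →
          7 ≤ n → ∀ z : ↥X.left, Order.height z = 2 →
            ∃ (s : Finset ↥X.left) (w : ↥X.left → ℤ),
              (∀ y ∈ s, IsLinearSubspacePoint 2 (n + 1) i y) ∧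
                IsRationallyEquivalent (primeCycle z) (∑ y ∈ s, w y • primeCycle y) 2)
    {k : Type u} [Field k] [IsAlgClosed k] [CharZero k] (n : ℕ) {X : SchemeOver k}
    (F : MvPolynomial (Fin (n + 1 + 1)) k) (i : X ⟶ projectiveSpace (n + 1) k)
    (hX : IsSmoothProjective n X) (hF : F.IsHomogeneous 3) (hirr : Irreducible F)
    [hi : IsClosedImmersion i.left]
    (hV : Set.range i.left.base =
      ProjectiveSpectrum.zeroLocus (MvPolynomial.homogeneousSubmodule (Fin (n + 1 + 1)) k) {F})
    (hn : 15 ≤ n) :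
    ChowGeneratedByLinearSubspaces 2 (n + 1) i ∧ Nonempty (ChowGroup X.left 2 ≃+ ℤ) := by
  haveI : CompactSpace ↥X.left := IsSmoothProjective.compactSpace_holds hX
  have hgen : ChowGeneratedByLinearSubspaces 2 (n + 1) i :=
    ChowGeneratedByLinearSubspaces.of_primeCycle (ha n F i hX hF hirr hi hV (by omega))
  exact ⟨hgen, nonempty_addEquiv_int_of_chowGeneratedByPlanes n F i hX hF hirr hV hn hgen⟩

end Inputs

end Hypersurface

end Literature.AlgebraicGeometry.Motives

end
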